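import Mathlib
import Literature.AlgebraicGeometry.Resolution.WeightedResolutionDatum

/-!
# The REFUTE-L1 specimen `g = z⁴ + x²y⁴ + s y⁵`: set-up and the order cap

[OURS · L1 W4.3 · chain w43, seat tri-2] Negative helper lemmas for crux `WeightedConstruction`
(stmt-ResolutionOfSingularities-0571), bearing on the retired line `pointwise-lexmax-hull`
(typed target `lexmaxHullRule_two_isEmpty`) and on the door card `certified-lexmax`.
NOT a statement of any manuscript; no Hironaka statement is used as a premise.
Companion file: `LexmaxHullRuleTwoEmptyGerms.lean` (the twisted-line cap (B)).

The specimen is the hypersurface `X = V(g) ⊂ 𝔸⁴ = Spec k[s, z, x, y]`,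
`g = z⁴ + x²y⁴ + s y⁵` (`X 0 = s`, `X 1 = z`, `X 2 = x`, `X 3 = y`), studied near the plane
`P = V(z, y)` and the line `ℓ = V(s, z, y) ⊂ P`.  Everything is pure commutative algebra, valid
over EVERY field `k`, phrased for an arbitrary localization `S` of `k[s,z,x,y]` at a point ideal,
in the vocabulary `weightedMonomialIdeal u w d = (u^α : Σ wᵢ αᵢ ≥ d)` of
`Literature/AlgebraicGeometry/Resolution/WeightedResolutionDatum.lean`.

* **(A) order cap** (this file). At every `k`-point `c` of `P` (`c 1 = c 3 = 0`), `g ∉ 𝔪_c⁵`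
  (`algebraMap_gSpec_not_mem_maximalIdeal_pow_five`); hence for every family `u : Fin m → S` of
  NON-UNITS and weights `w ≤ W`, `g ∈ weightedMonomialIdeal u w d → d ≤ 4 * W`
  (`gSpec_weightedMonomialIdeal_cap`): the smallest profile entry `d / max wᵢ` of any weighted
  chart presenting `g` in degree `d` is `≤ 4 = ord g`.
* Tools for (B) (this file): the projection `piX` / restriction `rho` to the `x`-line and the
  `I_ℓ`-rescaling `Phi : F ↦ F(sT, zT, x, yT)` into `k[s,z,x,y][T]`, whose `T⁰`-coefficient is
  `piX` and which sends `I_ℓⁿ` into `(Tⁿ)`.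

Method: evaluation / rescaling homomorphisms into one-variable polynomial rings turn
ideal-power membership into `T`-divisibility (`psi` for `𝔪_c`, `Phi` for `I_ℓ`).
-/

set_option linter.dupNamespace false

noncomputable section

open Polynomial (X C)
open Literature.AlgebraicGeometry.Resolution

namespace Summit.ResolutionOfSingularities.ResolutionOfSingularities.Theorems.WeightedConstruction.Negative.SpecimenGerms

variable (k : Type*) [Field k]

/-- The specimen `g = z⁴ + x²y⁴ + s y⁵ ∈ k[s, z, x, y]` (`X 0 = s`, `X 1 = z`, `X 2 = x`,
`X 3 = y`). -/
def gSpec : MvPolynomial (Fin 4) k :=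
  MvPolynomial.X 1 ^ 4 + MvPolynomial.X 2 ^ 2 * MvPolynomial.X 3 ^ 4 +
    MvPolynomial.X 0 * MvPolynomial.X 3 ^ 5

/-- The ideal of the `k`-point `c` of `𝔸⁴`: the kernel of evaluation at `c`. -/
def pointIdeal (c : Fin 4 → k) : Ideal (MvPolynomial (Fin 4) k) :=
  RingHom.ker (MvPolynomial.eval c)

/-- The ideal `I_ℓ = (s, z, y)` of the line `ℓ = V(s, z, y)`. -/
def lineIdeal : Ideal (MvPolynomial (Fin 4) k) :=
  Ideal.span {MvPolynomial.X 0, MvPolynomial.X 1, MvPolynomial.X 3}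

variable {k}

/-- Membership in the point ideal is vanishing at the point. -/
theorem mem_pointIdeal_iff (c : Fin 4 → k) (F : MvPolynomial (Fin 4) k) :
    F ∈ pointIdeal k c ↔ MvPolynomial.eval c F = 0 := RingHom.mem_ker

/-- The point ideal is maximal (kernel of a surjection onto the field `k`). -/
instance pointIdeal_isMaximal (c : Fin 4 → k) : (pointIdeal k c).IsMaximal :=
  RingHom.ker_isMaximal_of_surjective (MvPolynomial.eval c)
    (fun r => ⟨MvPolynomial.C r, MvPolynomial.eval_C r⟩)

/-! ## (A) The order cap: `g ∉ 𝔪_c⁵` at every point `c` of `P = V(z, y)` -/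

/-- Evaluation of all variables but `z` at the point `c`, `z ↦ c 1 + T`: a `k`-algebra map
`k[s,z,x,y] → k[T]`. -/
def psi (c : Fin 4 → k) : MvPolynomial (Fin 4) k →ₐ[k] Polynomial k :=
  MvPolynomial.aeval fun i => C (c i) + if i = 1 then Polynomial.X else 0

/-- `psi c F` at `T = 0` is the value `F(c)`. -/
theorem psi_eval_zero (c : Fin 4 → k) (F : MvPolynomial (Fin 4) k) :
    (psi c F).eval 0 = MvPolynomial.eval c F := by
  have h : (Polynomial.aeval (0 : k)).comp (psi c) = MvPolynomial.aeval c := by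
    refine MvPolynomial.algHom_ext fun i => ?_
    fin_cases i <;> simp [psi]
  have := congrArg (fun φ => φ F) h
  simpa [Polynomial.coe_aeval_eq_eval] using this

/-- `psi c` sends `𝔪_c` into `(T)`. -/
theorem X_dvd_psi_of_mem_pointIdeal (c : Fin 4 → k) {F : MvPolynomial (Fin 4) k}
    (hF : F ∈ pointIdeal k c) : Polynomial.X ∣ psi c F := by
  rw [Polynomial.X_dvd_iff, Polynomial.coeff_zero_eq_eval_zero, psi_eval_zero]
  exact (mem_pointIdeal_iff c F).mp hF

/-- `psi c` sends `𝔪_c` into `(T)` (ideal form). -/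
theorem map_psi_pointIdeal_le (c : Fin 4 → k) :
    (pointIdeal k c).map (psi c : MvPolynomial (Fin 4) k →+* Polynomial k) ≤
      Ideal.span {Polynomial.X} := by
  rw [Ideal.map_le_iff_le_comap]
  intro F hF
  rw [Ideal.mem_comap, Ideal.mem_span_singleton]
  exact X_dvd_psi_of_mem_pointIdeal c hF

/-- `psi c` sends `𝔪_cⁿ` into `(Tⁿ)`. -/
theorem X_pow_dvd_psi_of_mem_pointIdeal_pow (c : Fin 4 → k) (n : ℕ) {F : MvPolynomial (Fin 4) k}
    (hF : F ∈ pointIdeal k c ^ n) : Polynomial.X ^ n ∣ psi c F := by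
  have h1 : psi c F ∈ (pointIdeal k c ^ n).map (psi c : MvPolynomial (Fin 4) k →+* Polynomial k) :=
    Ideal.mem_map_of_mem _ hF
  rw [Ideal.map_pow] at h1
  have h2 := Ideal.pow_right_mono (map_psi_pointIdeal_le c) n h1
  rw [Ideal.span_singleton_pow, Ideal.mem_span_singleton] at h2
  exact h2

/-- At a point of `P = V(z, y)`, `psi c g = T⁴`. -/
theorem psi_gSpec (c : Fin 4 → k) (hc1 : c 1 = 0) (hc3 : c 3 = 0) :
    psi c (gSpec k) = Polynomial.X ^ 4 := by
  simp [psi, gSpec, hc1, hc3]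

/-- `m · g ∉ 𝔪_c⁵` for every `m` not vanishing at the point `c ∈ P`. -/
theorem mul_gSpec_not_mem_pointIdeal_pow_five (c : Fin 4 → k) (hc1 : c 1 = 0) (hc3 : c 3 = 0)
    {m : MvPolynomial (Fin 4) k} (hm : MvPolynomial.eval c m ≠ 0) :
    m * gSpec k ∉ pointIdeal k c ^ 5 := by
  intro h
  have h1 := X_pow_dvd_psi_of_mem_pointIdeal_pow c 5 h
  rw [map_mul, psi_gSpec c hc1 hc3, pow_succ'] at h1
  have hX4 : (Polynomial.X : Polynomial k) ^ 4 ≠ 0 := pow_ne_zero _ Polynomial.X_ne_zero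
  have h2 : Polynomial.X ∣ psi c m := (mul_dvd_mul_iff_right hX4).mp h1
  rw [Polynomial.X_dvd_iff, Polynomial.coeff_zero_eq_eval_zero, psi_eval_zero] at h2
  exact hm h2

section Local

variable (S : Type*) [CommRing S] [Algebra (MvPolynomial (Fin 4) k) S]

/-- In the local ring `S = k[s,z,x,y]_{𝔪_c}` of a point `c ∈ P = V(z, y)`: `g ∉ 𝔪⁵`
(the order of `g` at every point of `P` is at most — in fact exactly — `4`). -/
theorem algebraMap_gSpec_not_mem_maximalIdeal_pow_five (c : Fin 4 → k) (hc1 : c 1 = 0)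
    (hc3 : c 3 = 0) [IsLocalization.AtPrime S (pointIdeal k c)] [IsLocalRing S] :
    algebraMap (MvPolynomial (Fin 4) k) S (gSpec k) ∉ IsLocalRing.maximalIdeal S ^ 5 := by
  intro h
  rw [← IsLocalization.AtPrime.map_eq_maximalIdeal (pointIdeal k c) S, ← Ideal.map_pow,
    IsLocalization.algebraMap_mem_map_algebraMap_iff (pointIdeal k c).primeCompl S] at h
  obtain ⟨m, hm, hmg⟩ := h
  have hm' : MvPolynomial.eval c m ≠ 0 := fun h0 => hm ((mem_pointIdeal_iff c m).mpr h0)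
  exact mul_gSpec_not_mem_pointIdeal_pow_five c hc1 hc3 hm' hmg

/-- A product `∏ uᵢ ^ αᵢ` of elements of an ideal `J` lies in `J ^ (Σ αᵢ)`. -/
theorem prod_pow_mem_pow_sum {ι : Type*} (s : Finset ι) (J : Ideal S) (u : ι → S) (α : ι → ℕ)
    (hu : ∀ i ∈ s, u i ∈ J) : ∏ i ∈ s, u i ^ α i ∈ J ^ (∑ i ∈ s, α i) := by
  classical
  induction s using Finset.induction_on with
  | empty => simp
  | insert a s ha ih =>
    rw [Finset.prod_insert ha, Finset.sum_insert ha, pow_add]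
    exact Ideal.mul_mem_mul (Ideal.pow_mem_pow (hu a (Finset.mem_insert_self a s)) _)
      (ih fun i hi => hu i (Finset.mem_insert_of_mem hi))

/-- **(A) Order cap.** In the local ring of a point `c ∈ P`, if `g` lies in the degree-`d`
weighted monomial ideal of ANY family of non-units `u` with weights `≤ W`, then `d ≤ 4 W`:
the smallest entry `d / max wᵢ` of the profile of a weighted chart through `g` is at most `4`. -/
theorem gSpec_weightedMonomialIdeal_cap (c : Fin 4 → k) (hc1 : c 1 = 0) (hc3 : c 3 = 0)
    [IsLocalization.AtPrime S (pointIdeal k c)] [IsLocalRing S] {m : ℕ} (u : Fin m → S)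
    (w : Fin m → ℕ) (W d : ℕ) (hu : ∀ i, u i ∈ IsLocalRing.maximalIdeal S) (hw : ∀ i, w i ≤ W)
    (hg : algebraMap (MvPolynomial (Fin 4) k) S (gSpec k) ∈ weightedMonomialIdeal u w d) :
    d ≤ 4 * W := by
  by_contra hd
  push Not at hd
  apply algebraMap_gSpec_not_mem_maximalIdeal_pow_five S c hc1 hc3
  have hle : weightedMonomialIdeal u w d ≤ IsLocalRing.maximalIdeal S ^ 5 := by
    refine Ideal.span_le.mpr ?_
    rintro x ⟨α, hα, rfl⟩
    have h1 : ∑ i, w i * α i ≤ W * ∑ i, α i := by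
      rw [Finset.mul_sum]
      exact Finset.sum_le_sum fun i _ => Nat.mul_le_mul_right _ (hw i)
    have h5 : 5 ≤ ∑ i, α i := by
      by_contra h5
      push Not at h5
      have : W * ∑ i, α i ≤ W * 4 := Nat.mul_le_mul_left _ (by omega)
      omega
    exact Ideal.pow_le_pow_right h5 (prod_pow_mem_pow_sum S Finset.univ _ u α fun i _ => hu i)
  exact hle hg

end Local

/-! ## Tools for (B): the `x`-line projection and the `I_ℓ`-rescaling `Phi` -/

/-- The quartic `I_ℓ`-initial form `z⁴ + x²y⁴` of `g`. -/
def Fq : MvPolynomial (Fin 4) k :=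
  MvPolynomial.X 1 ^ 4 + MvPolynomial.X 2 ^ 2 * MvPolynomial.X 3 ^ 4

/-- Projection onto the `x`-line inside `k[s,z,x,y]`: `s, z, y ↦ 0`, `x ↦ x`. -/
def piX : MvPolynomial (Fin 4) k →ₐ[k] MvPolynomial (Fin 4) k :=
  MvPolynomial.aeval fun i => if i = 2 then MvPolynomial.X 2 else 0

/-- Restriction to the `x`-line as a one-variable polynomial: `s, z, y ↦ 0`, `x ↦ T`. -/
def rho : MvPolynomial (Fin 4) k →ₐ[k] Polynomial k :=
  MvPolynomial.aeval fun i => if i = 2 then Polynomial.X else 0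

/-- The `I_ℓ`-rescaling `F ↦ F(sT, zT, x, yT)`, a `k`-algebra map `k[s,z,x,y] → k[s,z,x,y][T]`;
its `T⁰`-coefficient is `piX`, and `T ^ n ∣ Phi F` whenever `F ∈ I_ℓ ^ n`. -/
def Phi : MvPolynomial (Fin 4) k →ₐ[k] Polynomial (MvPolynomial (Fin 4) k) :=
  MvPolynomial.aeval fun i =>
    if i = 2 then C (MvPolynomial.X 2) else C (MvPolynomial.X i) * Polynomial.X

/-- `Phi` on variables: `x ↦ x`, `s, z, y ↦ sT, zT, yT`. -/
@[simp] theorem Phi_X (i : Fin 4) :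
    Phi (k := k) (MvPolynomial.X i) =
      if i = 2 then C (MvPolynomial.X 2) else C (MvPolynomial.X i) * Polynomial.X :=
  MvPolynomial.aeval_X _ i

/-- Evaluating after `piX` = evaluating with `s, z, y` set to `0`. -/
theorem aeval_piX {A : Type*} [CommRing A] [Algebra k A] (v : Fin 4 → A)
    (F : MvPolynomial (Fin 4) k) :
    MvPolynomial.aeval v (piX F) = MvPolynomial.aeval (fun i => if i = 2 then v 2 else 0) F := by
  have h : (MvPolynomial.aeval v).comp piX =
      MvPolynomial.aeval (R := k) (fun i : Fin 4 => if i = 2 then v 2 else 0) := by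
    refine MvPolynomial.algHom_ext fun i => ?_
    fin_cases i <;> simp [piX]
  exact congrArg (fun φ => φ F) h

/-- A substitution fixing the `x`-line (`x ↦ T`) restricts `piX F` to `rho F`. -/
theorem aeval_piX_vec (a b d : Polynomial k) (F : MvPolynomial (Fin 4) k) :
    MvPolynomial.aeval ![a, b, Polynomial.X, d] (piX F) = rho F := by
  rw [aeval_piX]
  have hv : (fun i : Fin 4 => if i = 2 then ![a, b, Polynomial.X, d] 2 else 0) =
      fun i => if i = 2 then Polynomial.X else 0 := by
    funext i
    fin_cases i <;> simp
  rw [hv]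
  rfl

/-- At a point `c` of `ℓ`, `piX F` and `F` have the same value. -/
theorem eval_piX (c : Fin 4 → k) (hc0 : c 0 = 0) (hc1 : c 1 = 0) (hc3 : c 3 = 0)
    (F : MvPolynomial (Fin 4) k) : MvPolynomial.eval c (piX F) = MvPolynomial.eval c F := by
  have h := aeval_piX c F
  have hv : (fun i : Fin 4 => if i = 2 then c 2 else 0) = c := by
    funext i
    fin_cases i <;> simp [hc0, hc1, hc3]
  rw [hv] at h
  simpa using h

/-- At a point `c` of `ℓ`, `(rho F)(c 2) = F(c)`. -/
theorem eval_rho (c : Fin 4 → k) (hc0 : c 0 = 0) (hc1 : c 1 = 0) (hc3 : c 3 = 0)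
    (F : MvPolynomial (Fin 4) k) : (rho F).eval (c 2) = MvPolynomial.eval c F := by
  have h : (Polynomial.aeval (c 2)).comp (rho (k := k)) = MvPolynomial.aeval c := by
    refine MvPolynomial.algHom_ext fun i => ?_
    fin_cases i <;> simp [rho, hc0, hc1, hc3]
  have := congrArg (fun φ => φ F) h
  simpa [Polynomial.coe_aeval_eq_eval] using this

/-- The `T⁰`-coefficient of `Phi F` is the projection `piX F`. -/
theorem Phi_coeff_zero (F : MvPolynomial (Fin 4) k) : (Phi F).coeff 0 = piX F := by
  have h : ((Polynomial.aeval (R := MvPolynomial (Fin 4) k) (0 : MvPolynomial (Fin 4) k)).restrictScalars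
      k).comp (Phi (k := k)) = piX := by
    refine MvPolynomial.algHom_ext fun i => ?_
    fin_cases i <;> simp [Phi, piX]
  have := congrArg (fun φ => φ F) h
  simpa [Polynomial.coe_aeval_eq_eval, Polynomial.coeff_zero_eq_eval_zero] using this

/-- `Phi` sends `I_ℓ` into `(T)`. -/
theorem map_Phi_lineIdeal_le :
    (lineIdeal k).map
        (Phi (k := k) : MvPolynomial (Fin 4) k →+* Polynomial (MvPolynomial (Fin 4) k)) ≤
      Ideal.span {Polynomial.X} := by
  rw [lineIdeal, Ideal.map_span, Ideal.span_le]
  rintro _ ⟨F, hF, rfl⟩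
  simp only [Set.mem_insert_iff, Set.mem_singleton_iff] at hF
  rcases hF with rfl | rfl | rfl
  · exact Ideal.mem_span_singleton.mpr ⟨C (MvPolynomial.X 0),
      show Phi (MvPolynomial.X 0) = _ by rw [Phi_X, if_neg (by decide), mul_comm]⟩
  · exact Ideal.mem_span_singleton.mpr ⟨C (MvPolynomial.X 1),
      show Phi (MvPolynomial.X 1) = _ by rw [Phi_X, if_neg (by decide), mul_comm]⟩
  · exact Ideal.mem_span_singleton.mpr ⟨C (MvPolynomial.X 3),
      show Phi (MvPolynomial.X 3) = _ by rw [Phi_X, if_neg (by decide), mul_comm]⟩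

/-- `Phi` sends `I_ℓⁿ` into `(Tⁿ)`. -/
theorem X_pow_dvd_Phi_of_mem_lineIdeal_pow (n : ℕ) {F : MvPolynomial (Fin 4) k}
    (hF : F ∈ lineIdeal k ^ n) : Polynomial.X ^ n ∣ Phi F := by
  have h1 : Phi F ∈ (lineIdeal k ^ n).map
      (Phi (k := k) : MvPolynomial (Fin 4) k →+* Polynomial (MvPolynomial (Fin 4) k)) :=
    Ideal.mem_map_of_mem _ hF
  rw [Ideal.map_pow] at h1
  have h2 := Ideal.pow_right_mono map_Phi_lineIdeal_le n h1
  rw [Ideal.span_singleton_pow, Ideal.mem_span_singleton] at h2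
  exact h2

/-- `Phi g = T⁴ (z⁴ + x²y⁴) + T⁶ (s y⁵)`: the `I_ℓ`-initial form of `g` is the quartic `Fq`. -/
theorem Phi_gSpec :
    Phi (gSpec k) = Polynomial.X ^ 4 * C (Fq (k := k)) +
      Polynomial.X ^ 6 * C (MvPolynomial.X 0 * MvPolynomial.X 3 ^ 5) := by
  simp only [gSpec, Fq, map_add, map_mul, map_pow, Phi_X]
  simp
  ring

end Summit.ResolutionOfSingularities.ResolutionOfSingularities.Theorems.WeightedConstruction.Negative.SpecimenGerms

end
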